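import Summits.RiemannHypothesis.RiemannHypothesis.Theorems.Splittings.SplitXWucK1RJ
import HarnessLib

/-!
# Splittings — x-wuc GEN-11 `SplitXWucK1R` (K1′(ℝ) AT THE STAKE) — mechanical carve part 11/14
Continuation of `Summits.RiemannHypothesis.RiemannHypothesis.Theorems.Splittings.SplitXWucK1RJ`: byte-identical declaration units of the referee-passed extract `SplitXWucK1R.lean`
sha16 70c8eb2af2868881 (x-wuc g11; ref g10 PASS 2026-08-27T22:59:46Z; RULING #330); open namespaces/sections re-opened with their context.
HONEST LABEL: splitting search over kernel-typed RH-equivalences; K-CERT′ (complex `f`) stays OPEN; nothing here bears on the truth of RH.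
-/
set_option linter.dupNamespace false
noncomputable section
open scoped Classical ComplexConjugate
open Set Filter Topology Complex MeasureTheory
open Real Set Filter Topology
open Real Set MeasureTheory Complex Filter Topology
open scoped Real
namespace Summit.RiemannHypothesis.RiemannHypothesis.Theorems.Splittings.XWucG8.DSLine
/-- **LOCAL PAIRING BOUND.** `‖∫ 2 sinh(κ₀u) f‖ ≤ 2 (Mloc + 2τ(R)(M − Mloc)) sinh κ₀` for `0 ≤ κ₀ ≤ 1`, `Mloc` a bound of `‖T_f(·,0)‖`
on `|w| ≤ 2R` (`R ≥ π`), `M ≥ Mloc` a global bound. -/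
theorem norm_pairing_le_local (f : ℝ → ℂ) (hf : Continuous f) {M Mloc R : ℝ} (hM : ∀ y : ℝ, ‖tfT f y 0‖ ≤ M)
    (hR : π ≤ R) (hloc : ∀ w : ℝ, |w| ≤ 2 * R → ‖tfT f w 0‖ ≤ Mloc) (hMloc : Mloc ≤ M)
    {κ₀ : ℝ} (hκ₀ : 0 ≤ κ₀) (hκ₁ : κ₀ ≤ 1) :
    ‖∫ u in Icc (-1 : ℝ) 1, 2 * (Real.sinh (κ₀ * u) : ℂ) * f u‖
      ≤ 2 * (Mloc + 2 * (2 / (π * R) + 2 / R ^ 2) * (M - Mloc)) * Real.sinh κ₀ := by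
  set M' : ℝ := Mloc + 2 * (2 / (π * R) + 2 / R ^ 2) * (M - Mloc) with hM'
  set F : ℝ → ℂ := fun t => ∫ u in (-1 : ℝ)..1, f u * (Real.sinh (t * u) : ℂ) with hF
  set F' : ℝ → ℂ := fun t => ∫ u in (-1 : ℝ)..1, f u * ((u * Real.cosh (t * u) : ℝ) : ℂ) with hF'
  have hderiv : ∀ t, HasDerivAt F (F' t) t := fun t => hasDerivAt_sinhPairing f hf t
  have hbound : ∀ t : ℝ, 0 ≤ t → t ≤ 1 → ‖F' t‖ ≤ M' * Real.cosh t := by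
    intro t ht ht1
    have hkey : tfT₁ (fun u => f u * (Real.cosh (t * u) : ℂ)) 0 = I * F' t := by
      simp only [tfT₁, hF']
      rw [CoshKernel.tfT_interval, ← intervalIntegral.integral_const_mul]
      apply intervalIntegral.integral_congr
      intro u _
      simp only [zero_mul, Real.cosh_zero, Complex.ofReal_one, mul_one, Complex.ofReal_zero, mul_zero,
        Complex.exp_zero]
      push_cast; ring
    have h1 := norm_tfT₁_mul_cosh_le_local f hf hM hR hloc hMloc ht ht1
    rw [hkey, norm_mul, Complex.norm_I, one_mul, mul_comm] at h1
    exact h1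
  have hF0 : ‖F 0‖ ≤ (fun t => M' * Real.sinh t) 0 := by
    simp only [hF, zero_mul, Real.sinh_zero, Complex.ofReal_zero, mul_zero, intervalIntegral.integral_zero,
      norm_zero, le_refl]
  have hcomp := image_norm_le_of_norm_deriv_right_le_deriv_boundary (f := F) (f' := F') (a := 0) (b := κ₀)
    (B := fun t => M' * Real.sinh t) (B' := fun t => M' * Real.cosh t)
    (fun t _ => (hderiv t).continuousAt.continuousWithinAt) (fun t _ => (hderiv t).hasDerivWithinAt)
    hF0 (fun t => (Real.hasDerivAt_sinh t).const_mul M') (fun t ht => hbound t ht.1 (ht.2.le.trans hκ₁))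
  have hκ : ‖F κ₀‖ ≤ M' * Real.sinh κ₀ := hcomp ⟨hκ₀, le_refl _⟩
  have htarget : (∫ u in Icc (-1 : ℝ) 1, 2 * (Real.sinh (κ₀ * u) : ℂ) * f u) = 2 * F κ₀ := by
    simp only [hF]
    rw [integral_Icc_eq_integral_Ioc, ← intervalIntegral.integral_of_le (by norm_num : (-1 : ℝ) ≤ 1),
      ← intervalIntegral.integral_const_mul]
    apply intervalIntegral.integral_congr
    intro u _
    ring
  rw [htarget, norm_mul]
  calc ‖(2 : ℂ)‖ * ‖F κ₀‖ = 2 * ‖F κ₀‖ := by simp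
    _ ≤ 2 * (M' * Real.sinh κ₀) := by linarith [hκ]
    _ = 2 * M' * Real.sinh κ₀ := by ring

end Summit.RiemannHypothesis.RiemannHypothesis.Theorems.Splittings.XWucG8.DSLine
namespace Summit.RiemannHypothesis.RiemannHypothesis.Theorems.Splittings.XWucG8
end Summit.RiemannHypothesis.RiemannHypothesis.Theorems.Splittings.XWucG8
open Real Set MeasureTheory Complex Filter Topology
open scoped Real
namespace Summit.RiemannHypothesis.RiemannHypothesis.Theorems.Splittings.XWucG8.DSLine
/-- LOCAL core: `S'² + S² ≤ M²` and `|S| < M` on `[-L, L]` make `arccos (S/M)` 1-Lipschitz there. -/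
theorem arccos_lipschitz_local {S : ℝ → ℝ} {M L : ℝ} (hM : 0 < M)
    (hS : Differentiable ℝ S) (hDS : ∀ x, |x| ≤ L → deriv S x ^ 2 + S x ^ 2 ≤ M ^ 2)
    (hlt : ∀ x, |x| ≤ L → |S x| < M) (t : ℝ) (ht : |t| ≤ L) :
    Real.arccos (S t / M) ≤ Real.arccos (S 0 / M) + |t| := by
  have hL : 0 ≤ L := (abs_nonneg t).trans ht
  have hmem : ∀ x, x ∈ Icc (-L) L ↔ |x| ≤ L := fun x => by rw [mem_Icc, abs_le]
  set ψ : ℝ → ℝ := fun x => Real.arccos (S x / M) with hψ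
  have hne : ∀ x, |x| ≤ L → S x / M ≠ -1 ∧ S x / M ≠ 1 := by
    intro x hx
    have h := hlt x hx
    rw [abs_lt] at h
    constructor
    · intro h1; have : S x = -M := by field_simp at h1; linarith
      linarith
    · intro h1; have : S x = M := by field_simp at h1; linarith
      linarith
  have hderiv : ∀ x, |x| ≤ L → HasDerivAt ψ (-(1 / √(1 - (S x / M) ^ 2)) * (deriv S x / M)) x := by
    intro x hx
    have h1 : HasDerivAt (fun y => S y / M) (deriv S x / M) x := (hS x).hasDerivAt.div_const M
    have h2 : HasDerivAt (Real.arccos ∘ fun y => S y / M)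
        (-(1 / √(1 - (S x / M) ^ 2)) * (deriv S x / M)) x :=
      (Real.hasDerivAt_arccos (hne x hx).1 (hne x hx).2).comp x h1
    exact h2
  have hdiff : ∀ x ∈ Icc (-L) L, DifferentiableAt ℝ ψ x :=
    fun x hx => (hderiv x ((hmem x).mp hx)).differentiableAt
  have hbound : ∀ x ∈ Icc (-L) L, ‖deriv ψ x‖ ≤ 1 := by
    intro x hx'
    have hx := (hmem x).mp hx'
    rw [(hderiv x hx).deriv]
    have hlt' := hlt x hx
    rw [abs_lt] at hlt'
    have hpos : 0 < 1 - (S x / M) ^ 2 := by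
      have : (S x / M) ^ 2 < 1 := by
        rw [div_pow, div_lt_one (by positivity)]
        nlinarith [hlt'.1, hlt'.2]
      linarith
    have hsq : 0 < √(1 - (S x / M) ^ 2) := Real.sqrt_pos.mpr hpos
    rw [Real.norm_eq_abs, abs_mul, abs_neg, abs_div, abs_one, abs_of_pos hsq, one_div,
      ← div_eq_inv_mul, div_le_one hsq, abs_div, abs_of_pos hM]
    rw [div_le_iff₀ hM]
    -- |S'| ≤ M √(1 - S²/M²)  ⇐  S'² ≤ M² (1 - S²/M²) = M² - S²
    have hrhs : 0 ≤ √(1 - (S x / M) ^ 2) * M := by positivity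
    rw [← abs_of_nonneg hrhs, ← sq_le_sq, mul_pow, Real.sq_sqrt hpos.le]
    have : (1 - (S x / M) ^ 2) * M ^ 2 = M ^ 2 - S x ^ 2 := by field_simp
    rw [this]; linarith [hDS x hx]
  have key := Convex.norm_image_sub_le_of_norm_deriv_le hdiff hbound (convex_Icc _ _)
    ((hmem 0).mpr (by rw [abs_zero]; exact hL)) ((hmem t).mpr ht)
  rw [Real.norm_eq_abs, Real.norm_eq_abs, sub_zero] at key
  have := (abs_le.mp key).2
  simp only [hψ] at this ⊢; linarith

/-- **LOCAL DS lobe with defect.** `S'² + S² ≤ M²` on `[-L, L]` forces `M cos (arccos (S 0/M) + |t|) ≤ S t` for `|t| ≤ L` as long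
as `arccos (S 0 / M) + |t| ≤ π` (near-maximiser: `S 0 = M cos a₀`, lobe `M cos (a₀ + |t|)`). -/
theorem cos_lobe_local {S : ℝ → ℝ} {M L : ℝ} (hM : 0 < M)
    (hS : Differentiable ℝ S) (hDS : ∀ x, |x| ≤ L → deriv S x ^ 2 + S x ^ 2 ≤ M ^ 2)
    {t : ℝ} (ht : |t| ≤ L) (hta : Real.arccos (S 0 / M) + |t| ≤ π) :
    M * Real.cos (Real.arccos (S 0 / M) + |t|) ≤ S t := by
  have hL : 0 ≤ L := (abs_nonneg t).trans ht
  set A0 : ℝ := Real.arccos (S 0 / M) with hA0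
  -- ε-regularisation: S_ε := (1 - ε) S has |S_ε| < M on [-L, L].
  have hSM : ∀ x, |x| ≤ L → |S x| ≤ M := by
    intro x hx
    have h := hDS x hx
    exact abs_le_of_sq_le_sq (by nlinarith [sq_nonneg (deriv S x)]) hM.le
  have hmain : ∀ ε : ℝ, 0 < ε → ε < 1 →
      M * Real.cos (A0 + |t|) - M * |Real.arccos ((1 - ε) * (S 0 / M)) - A0| ≤ (1 - ε) * S t := by
    intro ε hε0 hε1
    set Se : ℝ → ℝ := fun x => (1 - ε) * S x with hSe
    have hSe_diff : Differentiable ℝ Se := by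
      intro x; exact (hS x).const_mul _
    have hSe_deriv : ∀ x, deriv Se x = (1 - ε) * deriv S x := by
      intro x; simp only [hSe]; exact deriv_const_mul _ (hS x)
    have hSe_DS : ∀ x, |x| ≤ L → deriv Se x ^ 2 + Se x ^ 2 ≤ M ^ 2 := by
      intro x hx
      rw [hSe_deriv]; simp only [hSe]
      have h := hDS x hx
      have h1 : (1 - ε) ^ 2 ≤ 1 := by nlinarith
      calc ((1 - ε) * deriv S x) ^ 2 + ((1 - ε) * S x) ^ 2
          = (1 - ε) ^ 2 * (deriv S x ^ 2 + S x ^ 2) := by ring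
        _ ≤ 1 * M ^ 2 := by gcongr
        _ = M ^ 2 := one_mul _
    have hSe_lt : ∀ x, |x| ≤ L → |Se x| < M := by
      intro x hx; simp only [hSe]
      rw [abs_mul, abs_of_pos (by linarith)]
      calc (1 - ε) * |S x| ≤ (1 - ε) * M := mul_le_mul_of_nonneg_left (hSM x hx) (by linarith)
        _ < M := by nlinarith
    have core := arccos_lipschitz_local hM hSe_diff hSe_DS hSe_lt t ht
    have hSe0 : Se 0 / M = (1 - ε) * (S 0 / M) := by simp only [hSe]; field_simp
    rw [hSe0] at core
    set Ae : ℝ := Real.arccos ((1 - ε) * (S 0 / M)) with hAe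
    -- cos is antitone on [0, π]: cos (arccos (Se t / M)) ≥ cos (min π (Ae + |t|))
    have hψ_le : Real.arccos (Se t / M) ≤ min π (Ae + |t|) :=
      le_min (Real.arccos_le_pi _) core
    have hcos : Real.cos (min π (Ae + |t|)) ≤ Real.cos (Real.arccos (Se t / M)) :=
      Real.cos_le_cos_of_nonneg_of_le_pi (Real.arccos_nonneg _) (min_le_left _ _) hψ_le
    have hval : Real.cos (Real.arccos (Se t / M)) = Se t / M := by
      have h := hSe_lt t ht; rw [abs_lt] at h
      apply Real.cos_arccos
      · rw [le_div_iff₀ hM]; linarith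
      · rw [div_le_iff₀ hM]; linarith
    rw [hval] at hcos
    -- cos is 1-Lipschitz: cos (min π (Ae + |t|)) ≥ cos (A0 + |t|) - |Ae - A0|  (A0 + |t| ≤ π)
    have hlip : Real.cos (A0 + |t|) - |Ae - A0| ≤ Real.cos (min π (Ae + |t|)) := by
      have h1 := Real.abs_cos_sub_cos_le (min π (Ae + |t|)) (A0 + |t|)
      have h2 : abs (min π (Ae + abs t) - (A0 + abs t)) ≤ |Ae - A0| := by
        rw [abs_le]; constructor
        · rcases le_total π (Ae + |t|) with hc | hc
          · rw [min_eq_left hc]; linarith [abs_nonneg (Ae - A0)]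
          · rw [min_eq_right hc]; linarith [neg_abs_le (Ae - A0)]
        · linarith [min_le_right π (Ae + |t|), le_abs_self (Ae - A0)]
      have h3 := (abs_le.mp (h1.trans h2)).1
      linarith
    have : M * (Real.cos (A0 + |t|) - |Ae - A0|) ≤ M * (Se t / M) := by
      exact mul_le_mul_of_nonneg_left (hlip.trans hcos) hM.le
    have h4 : M * (Se t / M) = (1 - ε) * S t := by simp only [hSe]; field_simp
    rw [h4] at this; linarith
  -- let ε → 0⁺
  have h_lhs : Tendsto (fun ε : ℝ => M * Real.cos (A0 + |t|) - M * |Real.arccos ((1 - ε) * (S 0 / M)) - A0|) (𝓝[>] 0)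
      (𝓝 (M * Real.cos (A0 + |t|) - M * |Real.arccos ((1 - 0) * (S 0 / M)) - A0|)) := by
    have hc : Continuous
        (fun ε : ℝ => M * Real.cos (A0 + |t|) - M * |Real.arccos ((1 - ε) * (S 0 / M)) - A0|) := by
      have := Real.continuous_arccos
      fun_prop
    exact (hc.tendsto 0).mono_left nhdsWithin_le_nhds
  have h_rhs : Tendsto (fun ε : ℝ => (1 - ε) * S t) (𝓝[>] 0) (𝓝 ((1 - 0) * S t)) := by
    have hc : Continuous (fun ε : ℝ => (1 - ε) * S t) := by continuity
    exact (hc.tendsto 0).mono_left nhdsWithin_le_nhds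
  rw [sub_zero, one_mul, ← hA0, sub_self, abs_zero, mul_zero, sub_zero] at h_lhs
  rw [sub_zero, one_mul] at h_rhs
  have hev : ∀ᶠ ε in 𝓝[>] (0 : ℝ),
      M * Real.cos (A0 + |t|) - M * |Real.arccos ((1 - ε) * (S 0 / M)) - A0| ≤ (1 - ε) * S t := by
    filter_upwards [Ioo_mem_nhdsGT (zero_lt_one' ℝ)] with ε hε using hmain ε hε.1 hε.2
  exact le_of_tendsto_of_tendsto h_lhs h_rhs hev

end Summit.RiemannHypothesis.RiemannHypothesis.Theorems.Splittings.XWucG8.DSLine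
namespace Summit.RiemannHypothesis.RiemannHypothesis.Theorems.Splittings.XWucG8
end Summit.RiemannHypothesis.RiemannHypothesis.Theorems.Splittings.XWucG8
open Real Set MeasureTheory Complex Filter Topology
open scoped Real
namespace Summit.RiemannHypothesis.RiemannHypothesis.Theorems.Splittings.XWucG8.DSLine
open scoped ComplexConjugate
/-- **LOCAL lobe at a NEAR-maximiser.** If the real Duffin–Schaeffer form `(w T)re² + (w T₁)re² ≤ Mx²` (`‖w‖ ≤ 1`) holds for
`|y − lam₀| ≤ π` only and `‖T(lam₀)‖ = m > 0`, then `Mx cos (arccos (m/Mx) + |t|) ≤ ‖T(lam₀ + t)‖` whenever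
`arccos (m/Mx) + |t| ≤ π` (defect angle `a₀ = arccos (m/Mx)`). -/
theorem lobe_at_nearmax_local (g : ℝ → ℂ) (hg : Continuous g) {lam₀ m Mx : ℝ} (hM : 0 < m) (hMx : 0 < Mx)
    (hDSloc : ∀ y : ℝ, |y - lam₀| ≤ π → ∀ w : ℂ, ‖w‖ ≤ 1 →
      (w * tfT g y 0).re ^ 2 + (w * tfT₁ g y).re ^ 2 ≤ Mx ^ 2)
    (hat : ‖tfT g lam₀ 0‖ = m) {t : ℝ} (ht : |t| ≤ π) (hta : Real.arccos (m / Mx) + |t| ≤ π) :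
    Mx * Real.cos (Real.arccos (m / Mx) + |t|) ≤ ‖tfT g (lam₀ + t) 0‖ := by
  set c : ℂ := conj (tfT g lam₀ 0) / (m : ℂ) with hc
  have hc1 : ‖c‖ = 1 := by
    rw [hc, norm_div, RCLike.norm_conj, hat, Complex.norm_real, Real.norm_eq_abs, abs_of_pos hM,
      div_self hM.ne']
  set S : ℝ → ℝ := fun y => (c * tfT g y 0).re with hS
  have hSd : ∀ y, HasDerivAt S ((c * tfT₁ g y).re) y := by
    intro y
    have h1 := (hasDerivAt_tfT g hg y).const_mul c
    exact Complex.reCLM.hasFDerivAt.comp_hasDerivAt y h1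
  have hSdiff : Differentiable ℝ S := fun y => (hSd y).differentiableAt
  have hDS : ∀ y, |y - lam₀| ≤ π → deriv S y ^ 2 + S y ^ 2 ≤ Mx ^ 2 := by
    intro y hy
    rw [(hSd y).deriv]
    have := hDSloc y hy c hc1.le
    simp only [hS]; linarith
  have hS0 : S lam₀ = m := by
    have e : c * tfT g lam₀ 0 = ((Complex.normSq (tfT g lam₀ 0) / m : ℝ) : ℂ) := by
      rw [hc, div_mul_eq_mul_div, mul_comm, Complex.mul_conj, Complex.ofReal_div]
    simp only [hS]
    rw [e, Complex.ofReal_re, Complex.normSq_eq_norm_sq, hat, pow_two, mul_div_assoc, div_self hM.ne', mul_one]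
  have hlobe' := cos_lobe_local (S := fun s => S (lam₀ + s)) (L := π) hMx
    (hSdiff.comp (differentiable_id.const_add lam₀)) ?_ ht (by simp only [add_zero]; rw [hS0]; exact hta)
  · simp only [add_zero] at hlobe'
    rw [hS0] at hlobe'
    calc Mx * Real.cos (Real.arccos (m / Mx) + |t|) ≤ S (lam₀ + t) := hlobe'
      _ ≤ ‖c * tfT g (lam₀ + t) 0‖ := le_trans (le_abs_self _) (Complex.abs_re_le_norm _)
      _ = ‖tfT g (lam₀ + t) 0‖ := by rw [norm_mul, hc1, one_mul]
  · intro s hs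
    rw [deriv_comp_const_add]
    exact hDS (lam₀ + s) (by rw [add_sub_cancel_left]; exact hs)

/-- **LOCAL LOBE PROFILE at a near-maximiser.** Local DS form (`|y − lam₀| ≤ π`) and LOCAL dent
`‖T(x,κ) − (sinh κ/κ)T(x,0)‖ ≤ (cosh κ − sinh κ/κ)·Mx` (`|x − lam₀| ≤ π`, `0 < κ ≤ 1/2`) give, with `a₀ = arccos (m/Mx)`,
`Mx·((25/24) cos (a₀ + |t|) − D) ≤ ‖tfT g (lam₀ + t) κ‖` for `κ ∈ [0, 1/2]`, `|t| ≤ π`, `a₀ + |t| ≤ π`. -/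
theorem lobe_profile_local (g : ℝ → ℂ) (hg : Continuous g) {lam₀ m Mx : ℝ} (hm : 0 < m) (hM : 0 < Mx)
    (hDSloc : ∀ y : ℝ, |y - lam₀| ≤ π → ∀ w : ℂ, ‖w‖ ≤ 1 →
      (w * tfT g y 0).re ^ 2 + (w * tfT₁ g y).re ^ 2 ≤ Mx ^ 2)
    (hdentloc : ∀ x : ℝ, |x - lam₀| ≤ π → ∀ κ : ℝ, 0 < κ → κ ≤ 1 / 2 →
      ‖tfT g x κ - (Real.sinh κ / κ : ℝ) * tfT g x 0‖ ≤ (Real.cosh κ - Real.sinh κ / κ) * Mx)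
    (hat : ‖tfT g lam₀ 0‖ = m)
    {κ : ℝ} (hκ0 : 0 ≤ κ) (hκ : κ ≤ 1 / 2) {t : ℝ} (ht : |t| ≤ π) (hta : Real.arccos (m / Mx) + |t| ≤ π) :
    Mx * (25 / 24 * Real.cos (Real.arccos (m / Mx) + |t|) - (Real.cosh (1 / 2) - 25 / 24))
      ≤ ‖tfT g (lam₀ + t) κ‖ := by
  have hlobe := lobe_at_nearmax_local g hg hm hM hDSloc hat ht hta
  set M : ℝ := Mx with hMdef
  set A : ℝ := Real.arccos (m / Mx) with hA
  set D : ℝ := Real.cosh (1 / 2) - 25 / 24 with hD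
  have hD12 : 1 / 12 ≤ D := D_bounds.1
  have hc1 : Real.cos (A + |t|) ≤ 1 := Real.cos_le_one _
  by_cases hct : 0 ≤ Real.cos (A + |t|)
  · rcases eq_or_lt_of_le hκ0 with h0 | hpos
    · rw [← h0]
      have h' : 25 / 24 * Real.cos (A + |t|) - D ≤ Real.cos (A + |t|) := by linarith
      exact le_trans (mul_le_mul_of_nonneg_left h' hM.le) hlobe
    · have hdent := hdentloc (lam₀ + t) (by rw [add_sub_cancel_left]; exact ht) κ hpos hκ
      set r : ℝ := Real.sinh κ / κ with hr
      have hr1 : 1 + κ ^ 2 / 6 ≤ r := by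
        rw [hr, le_div_iff₀ hpos]
        have := SignConeRung.sinh_lower hpos.le
        have e : (1 + κ ^ 2 / 6) * κ = κ + κ ^ 3 / 6 := by ring
        linarith
      have hr0 : 0 ≤ r := le_trans (by positivity) hr1
      have hrev : r * ‖tfT g (lam₀ + t) 0‖ - (Real.cosh κ - r) * M ≤ ‖tfT g (lam₀ + t) κ‖ := by
        have h1 := norm_sub_norm_le ((r : ℂ) * tfT g (lam₀ + t) 0) (tfT g (lam₀ + t) κ)
        have h2 : ‖(r : ℂ) * tfT g (lam₀ + t) 0‖ = r * ‖tfT g (lam₀ + t) 0‖ := by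
          rw [norm_mul, Complex.norm_real, Real.norm_eq_abs, abs_of_nonneg hr0]
        rw [norm_sub_rev, h2] at h1
        linarith
      have e2 : r * (M * Real.cos (A + |t|)) ≤ r * ‖tfT g (lam₀ + t) 0‖ := mul_le_mul_of_nonneg_left hlobe hr0
      have hpsi := antitoneOn_psi (X := 1 + Real.cos (A + |t|)) (by linarith)
        (show κ ∈ Ici (0 : ℝ) from hκ0) (show (1 / 2 : ℝ) ∈ Ici (0 : ℝ) by norm_num) hκ
      simp only at hpsi
      have e3 : (1 + κ ^ 2 / 6) * (1 + Real.cos (A + |t|)) ≤ r * (1 + Real.cos (A + |t|)) :=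
        mul_le_mul_of_nonneg_right hr1 (by linarith)
      have e4 : M * ((1 + (1 / 2 : ℝ) ^ 2 / 6) * (1 + Real.cos (A + |t|)) - Real.cosh (1 / 2)) ≤
          M * (r * (1 + Real.cos (A + |t|)) - Real.cosh κ) := mul_le_mul_of_nonneg_left (by linarith) hM.le
      have e5 : M * (25 / 24 * Real.cos (A + |t|) - D) =
          M * ((1 + (1 / 2 : ℝ) ^ 2 / 6) * (1 + Real.cos (A + |t|)) - Real.cosh (1 / 2)) := by rw [hD]; ring
      have e6 : M * (r * (1 + Real.cos (A + |t|)) - Real.cosh κ)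
          = r * (M * Real.cos (A + |t|)) - (Real.cosh κ - r) * M := by
        ring
      rw [e5]
      linarith [e4, e6, e2, hrev]
  · have hneg : Real.cos (A + |t|) < 0 := not_le.mp hct
    have : M * (25 / 24 * Real.cos (A + |t|) - D) < 0 := mul_neg_of_pos_of_neg hM (by linarith)
    linarith [norm_nonneg (tfT g (lam₀ + t) κ)]

/-- **LOCAL per-lobe level bound at a near-maximiser:** with defect angle `a₀ = arccos (m/Mx)` the 16-level certificate on the
SHRUNK windows `c ± (π/2 − y_j − a₀)` with heights `Mx²(s_j² − s_{j+1}²)` lies below `‖tfT g · κ‖²` — from LOCAL data only. -/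
theorem lobe_levels_local (g : ℝ → ℂ) (hg : Continuous g) {c m Mx : ℝ} (hm : 0 < m) (hM : 0 < Mx)
    (hDSloc : ∀ y : ℝ, |y - c| ≤ π → ∀ w : ℂ, ‖w‖ ≤ 1 →
      (w * tfT g y 0).re ^ 2 + (w * tfT₁ g y).re ^ 2 ≤ Mx ^ 2)
    (hdentloc : ∀ x : ℝ, |x - c| ≤ π → ∀ κ : ℝ, 0 < κ → κ ≤ 1 / 2 →
      ‖tfT g x κ - (Real.sinh κ / κ : ℝ) * tfT g x 0‖ ≤ (Real.cosh κ - Real.sinh κ / κ) * Mx)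
    (hat : ‖tfT g c 0‖ = m) {lam κ : ℝ} (hκ0 : 0 ≤ κ) (hκ : κ ≤ 1 / 2) :
    (∑ j ∈ (Finset.range 16).filter
        (fun j => c - (π / 2 - yN j - Real.arccos (m / Mx)) < lam ∧ lam ≤ c + (π / 2 - yN j - Real.arccos (m / Mx))),
      Mx ^ 2 * (sN j ^ 2 - sN (j + 1) ^ 2)) ≤ ‖tfT g lam κ‖ ^ 2 := by
  set M : ℝ := Mx with hMdef
  set A : ℝ := Real.arccos (m / Mx) with hA
  have hA0 : 0 ≤ A := Real.arccos_nonneg _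
  have hsum := level_sum_le (k := 16) (fun j => M ^ 2 * sN j ^ 2)
    (fun j => by
      have h1 := sN_succ_le j
      have h2 := sN_nonneg (j + 1)
      have : sN (j + 1) ^ 2 ≤ sN j ^ 2 := pow_le_pow_left₀ h2 h1 2
      exact mul_le_mul_of_nonneg_left this (sq_nonneg M))
    (fun j => by positivity)
    ((Finset.range 16).filter (fun j => c - (π / 2 - yN j - A) < lam ∧ lam ≤ c + (π / 2 - yN j - A)))
    (Finset.filter_subset _ _) (P := ‖tfT g lam κ‖ ^ 2) (by positivity) ?_
  · calc (∑ j ∈ (Finset.range 16).filter (fun j => c - (π / 2 - yN j - A) < lam ∧ lam ≤ c + (π / 2 - yN j - A)),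
          M ^ 2 * (sN j ^ 2 - sN (j + 1) ^ 2))
        = ∑ j ∈ (Finset.range 16).filter (fun j => c - (π / 2 - yN j - A) < lam ∧ lam ≤ c + (π / 2 - yN j - A)),
          (M ^ 2 * sN j ^ 2 - M ^ 2 * sN (j + 1) ^ 2) := by
          apply Finset.sum_congr rfl; intro j _; ring
      _ ≤ ‖tfT g lam κ‖ ^ 2 := hsum
  · intro j hj
    rw [Finset.mem_filter] at hj
    obtain ⟨hjk, h1, h2⟩ := hj
    have hj16 := Finset.mem_range.mp hjk
    obtain ⟨hy1, hy2⟩ := yN_mem j hj16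
    have hπ := Real.pi_gt_d6
    have ht : |lam - c| ≤ π / 2 - yN j - A := abs_le.mpr ⟨by linarith, by linarith⟩
    have htπ : |lam - c| ≤ π := by linarith
    have hta : A + |lam - c| ≤ π / 2 - yN j := by linarith
    have hprof := lobe_profile_local g hg hm hM hDSloc hdentloc hat hκ0 hκ htπ (by linarith)
    rw [show c + (lam - c) = lam by ring] at hprof
    have hcos : yN j - yN j ^ 3 / 6 ≤ Real.cos (A + |lam - c|) := by
      have h3 : Real.cos (π / 2 - yN j) ≤ Real.cos (A + |lam - c|) :=
        Real.cos_le_cos_of_nonneg_of_le_pi (by positivity) (by linarith) hta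
      rw [Real.cos_pi_div_two_sub] at h3
      have h4 := Real.sin_gt_sub_cube (show 0 < yN j by linarith)
      linarith
    obtain ⟨hs0, hs⟩ := sN_cert j hj16
    have hD := D_bounds.2
    have h5 : sN j ≤ 25 / 24 * Real.cos (A + |lam - c|) - (Real.cosh (1 / 2) - 25 / 24) := by linarith
    have h6 : M * sN j ≤ ‖tfT g lam κ‖ := le_trans (mul_le_mul_of_nonneg_left h5 hM.le) hprof
    have h7 : 0 ≤ M * sN j := by positivity
    show M ^ 2 * sN j ^ 2 ≤ ‖tfT g lam κ‖ ^ 2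
    calc M ^ 2 * sN j ^ 2 = (M * sN j) ^ 2 := by ring
      _ ≤ ‖tfT g lam κ‖ ^ 2 := pow_le_pow_left₀ h7 h6 2

/-- the credit with defect: shrinking each of the 16 windows by `a` on both sides costs at most `2a·s₀²` of credit. -/
theorem credit16_defect (a : ℝ) (ha : 0 ≤ a) : (571 : ℝ) / 2500 - 2 * a * sN 0 ^ 2 ≤
    ∑ j ∈ Finset.range 16, (sN j ^ 2 - sN (j + 1) ^ 2) * (1641592 / 1000000 - 2 * yN j - 2 * a) := by
  have h := credit16
  have e : ∑ j ∈ Finset.range 16, (sN j ^ 2 - sN (j + 1) ^ 2) * (1641592 / 1000000 - 2 * yN j - 2 * a)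
      = (∑ j ∈ Finset.range 16, (sN j ^ 2 - sN (j + 1) ^ 2) * (1641592 / 1000000 - 2 * yN j))
        - 2 * a * ∑ j ∈ Finset.range 16, (sN j ^ 2 - sN (j + 1) ^ 2) := by
    rw [Finset.mul_sum, ← Finset.sum_sub_distrib]
    apply Finset.sum_congr rfl; intro j _; ring
  have tel : ∑ j ∈ Finset.range 16, (sN j ^ 2 - sN (j + 1) ^ 2) = sN 0 ^ 2 - sN 16 ^ 2 := by
    simp only [Finset.sum_range_succ, Finset.sum_range_zero]; ring
  rw [e, tel]
  nlinarith [sq_nonneg (sN 16)]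

/-- `s₀² ≤ 0.4234` (so the defect cost is `≤ 0.847·a₀`). -/
theorem sN_zero_sq_le : sN 0 ^ 2 ≤ 4234 / 10000 := by norm_num [sN, sL]

end Summit.RiemannHypothesis.RiemannHypothesis.Theorems.Splittings.XWucG8.DSLine
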